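import Summits.CriticalPhenomena.SAWScalingLimit.Theorems.SAWSpinMonotoneArrivalFlatteningSpinChordDefs

/-!
# Vocabulary of line `Sketch` (adjacent-port reduction) for the crux `SpinMonotone` (stmt-CriticalPhenomena-16769)

Route `SAWSpinMonotone` (sub-problem `CriticalPhenomena/SAWScalingLimit`), crux
`Summit.CriticalPhenomena.SAWScalingLimit.Theses.SAWSpinMonotone.SpinMonotone` (item stmt-CriticalPhenomena-16769): for every
simply connected hexagonal domain `Λ`, boundary mid-edge `a`, vertex `v ∈ Λ` and pairwise distinct neighbours `w₀ w₁ w₂` of `v`,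
the modulus of the port sum `s ↦ ‖Σⱼ F_{Λ∖v}(a, {v,wⱼ}; x_c, s)‖` is antitone on `[0, 3/2]`.

This file is the **definitions module** of the registered skeleton `Cruxes/SpinMonotone/Lines/Sketch.lean` (lead
`prover-line-stmt-CriticalPhenomena-16769-0`, `ledger skeleton check` OK; stubs `stub_normSq_threeTerm`, `stub_threeTermViolation`,
`stub_threeTermAntitone`, `stub_exists_farPort`, `stub_adjacentPortInequality`, `stub_nonAdjacentSpinMonotone`,
`stub_adjacentWinding`). It carries, sorry-free and in the skeleton's namespace, the line's VOCABULARY for the boundary-adjacent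
regime of the crux — the configurations `(Λ, u, w₁, v, p, q)` in which the target `v` is adjacent to the source vertex `w₁` of
`a = {u, w₁}` (`u ∉ Λ`), `q` being the FAR port of `v` (`IsFarPort`, a lattice `3`-path from `u` avoiding `w₁`) and `p` the mid
port. There every first arrival at `v` has a winding fixed by its port (`ε·π/3`, `ε·π`, `ε·5π/3`; stub `stub_adjacentWinding`,
landed as `Theorems/SAWSpinMonotoneSpinMonotoneAdjacentWinding.lean`), the port sum is a three-term trigonometric sum of the port
masses `portMass Λ a v ·` of `…SpinChordDefs`, and the crux's antitonicity there is EQUIVALENT to the scalar inequality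
`4·m(w₁)·m(q) ≤ m(p)·(m(w₁) + m(q))` (`AdjacentPortInequality`; stubs `stub_normSq_threeTerm`, `stub_threeTermViolation`,
`stub_threeTermAntitone`). `AdjacentPortWitness` is its negation at ONE configuration: the hypothesis of the line's negative-modulo
lemma `SpinMonotone_false_of_AdjacentPortWitness : AdjacentPortWitness → ¬ SpinMonotone` (exact transfer matrices on notched
armchair strips put the margin at `0.045 → 0.003` for widths `2 → 11` with a `W⁻²` law and a negative limit, card
`Cruxes/SpinMonotone/Ideas/notched-strip-transfer-matrix.md`; a witness, if it exists, has width `≈ 20` and is a certified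
computation, not a Lean construction). Nothing in this file is asserted: every `def … : Prop` is a statement.

Sources: H. Duminil-Copin, S. Smirnov, *The connective constant of the honeycomb lattice equals `√(2+√2)`*, Ann. of Math. 175
(2012) 1653–1665 (arXiv:1007.0575), §1–2 (walks between mid-edges, Definition 1, "we used the fact that `a` is on the boundary and
`Ω` is simply connected"); the cards `Cruxes/SpinMonotone/PICKED.md`, `Cruxes/SpinMonotone/Ideas/notched-strip-transfer-matrix.md`.
Deliberately NOT here: any theorem (the reduction, the equivalence and the negative lemma live in the stub files and in
`Theorems/SAWSpinMonotoneSpinMonotone/Negative/…`).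
-/

noncomputable section

namespace Summit.CriticalPhenomena.SAWScalingLimit.Cruxes.SpinMonotone.AdjacentPort

open Literature.Probability.LatticeModels
open Literature.Probability.RandomPlanarGeometry Literature.Probability.RandomPlanarGeometry.SAW
open Summit.CriticalPhenomena.SAWScalingLimit.Cruxes.ArrivalFlattening.SpinChord (portMass)

/-- **Far port.** For the boundary mid-edge `{u, w₁}` (`u` outside) and a target `v ∼ w₁`, the neighbour `q` of `v` is the FAR
port iff `u` reaches `q` by a lattice path of length `3` avoiding `w₁` (then `u, w₁, v, q` and that path bound one hexagon, and
the walk `u → w₁ → v → q` turns twice in the same sense; the first arrivals at `{v, q}` wind by `±5π/3`). Purely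
graph-theoretic, hence invariant under the charts of `HexParafermionTransport`. A definition, not a statement. -/
def IsFarPort (u w₁ q : HexVertex) : Prop :=
  ∃ x y : HexVertex, x ≠ w₁ ∧ hexGraph.Adj u x ∧ hexGraph.Adj x y ∧ hexGraph.Adj y q

/-- **Adjacent configuration** `(Λ, u, w₁, v, p, q)`: `Λ` simply connected, `a = {u, w₁}` a boundary mid-edge (`u ∉ Λ ∋ w₁`),
the target `v ∈ Λ` adjacent to the source vertex `w₁`, and `w₁, p, q` the three pairwise distinct neighbours of `v` with `q`
the far port (hence `p` the mid port). A definition, not a statement. -/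
def AdjacentConfig (Λ : Finset HexVertex) (u w₁ v p q : HexVertex) : Prop :=
  hexDomainSimplyConnected Λ ∧ u ∉ Λ ∧ w₁ ∈ Λ ∧ v ∈ Λ ∧ hexGraph.Adj u w₁ ∧ hexGraph.Adj v w₁ ∧
    hexGraph.Adj v p ∧ hexGraph.Adj v q ∧ w₁ ≠ p ∧ p ≠ q ∧ w₁ ≠ q ∧ IsFarPort u w₁ q

/-- **The adjacent-port inequality** (statement; the computable conjunct of the crux, registered stub
`stub_adjacentPortInequality` in spelled-out form): at EVERY adjacent configuration the three port masses
`m₀ = portMass Λ {u,w₁} v w₁ (= x_c)`, `m₁ = portMass Λ {u,w₁} v p` (mid), `m₂ = portMass Λ {u,w₁} v q` (far) satisfy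
`4·m₀·m₂ ≤ m₁·(m₀ + m₂)` — equivalently, the modulus of `m₀ + m₁e^{-iφ} + m₂e^{-2iφ}` is non-increasing on `φ ∈ [0, π]`.
Implied by `SpinMonotone`; forecast FALSE on wide notched strips (card `notched-strip-transfer-matrix`). Not asserted here. -/
def AdjacentPortInequality : Prop :=
  ∀ (Λ : Finset HexVertex) (u w₁ v p q : HexVertex), AdjacentConfig Λ u w₁ v p q →
    4 * portMass Λ s(u, w₁) v w₁ * portMass Λ s(u, w₁) v q ≤
      portMass Λ s(u, w₁) v p * (portMass Λ s(u, w₁) v w₁ + portMass Λ s(u, w₁) v q)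

/-- **An adjacent-port witness** (statement; hypothesis of the negative-modulo lemma
`SpinMonotone_false_of_AdjacentPortWitness`): ONE adjacent configuration at which the inequality fails strictly,
`m₁·(m₀ + m₂) < 4·m₀·m₂`. Its construction is a certified transfer-matrix computation on a truncated notched armchair strip
(width `≈ 20`, `≈ 2·10³` vertices), out of reach of enumeration inside Lean. Not asserted here. -/
def AdjacentPortWitness : Prop :=
  ∃ (Λ : Finset HexVertex) (u w₁ v p q : HexVertex), AdjacentConfig Λ u w₁ v p q ∧
    portMass Λ s(u, w₁) v p * (portMass Λ s(u, w₁) v w₁ + portMass Λ s(u, w₁) v q) <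
      4 * portMass Λ s(u, w₁) v w₁ * portMass Λ s(u, w₁) v q

end Summit.CriticalPhenomena.SAWScalingLimit.Cruxes.SpinMonotone.AdjacentPort

end
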